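import Mathlib
import Literature.NumberTheory.LFunctions.Zhang2022.SkeletonPartOne
import Literature.NumberTheory.LFunctions.Zhang2022.Section3MeanValues
import HarnessLib

/-!
# Zhang (2022) §3, Lemma 3.3: the skeleton leaves `Lemma33a`, `Lemma33b` DISCHARGED

Topic `Literature/NumberTheory/LFunctions/Zhang2022` (Landau–Siegel adjudication tree;
verdict-neutral). Y. Zhang, *Discrete mean estimates and the Landau–Siegel zero*,
arXiv:2211.02515v1 (2022) [Zhang2022LandauSiegel], §3, Lemma 3.3 (PDF p. 14, tex L779):

> **Lemma 3.3.** For any `s` and any complex numbers `c(n)` we have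
> `Σ_{ψ∈Ψ} |Σ_{n≤P} c(n)ψ(n)n^{−s}|² ≪ 𝔓 Σ_{n≤P} |c(n)|² n^{−2σ}`
> and
> `Σ_{ψ∈Ψ} |Σ_{n≤P²} c(n)ψ(n)n^{−s}|² ≪ P² Σ_{n≤P²} |c(n)|² n^{−2σ}`.
> *Proof.* The first assertion follows by the orthogonality relation; the second assertion
> follows by the large sieve inequality. □

The typed skeleton states the two assertions as the CLAIM nodes `Skeleton.Lemma33a`,
`Skeleton.Lemma33b` (`SkeletonPartOne.lean`; they are the leaves `h33a`, `h33b` of the whole-DAG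
theorem `Skeleton.theorem1_of_leaves`), over the family `Ψ` typed as the finite type `Chr D`
(`∑ᶠ x : Chr D`). The tree already PROVES both inequalities in modulus-indexed form
(`Zhang2022.weighted_orthogonality_meanValue`, implied constant `1`;
`Zhang2022.weighted_largeSieve_meanValue`, factor `N + 1 + 2Q²`, from the tree's large sieve for
primitive characters) in `Section3MeanValues.lean`. This file supplies the bookkeeping identity
`Σ_{ψ∈Ψ} g = Σ_{p∼P} Σ*_{ψ mod p} g` (`Skeleton.finsum_chr_eq`) and concludes

* `Skeleton.lemma33a_holds : Lemma33a` with `C = 1`;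
* `Skeleton.lemma33b_holds : Lemma33b` with the absolute constant `C = 2 + 2(3 + (log 2)⁻⁶⁸)²`
  (for `D ≥ 3` the large-sieve factor `⌊P²⌋ + 1 + 2⌈P(1+𝓛⁻⁶⁸)⌉²` is `≤ 20P²`; the skeleton's node
  quantifies over every `D`, and the only modulus with `𝓛⁻⁶⁸ > 1` is `D = 2`, absorbed into `C`).

No new definitions, no new named facts; nothing here bears on Theorems 1–2 of the source.

## References

* Y. Zhang, arXiv:2211.02515v1 (2022), §3 Lemma 3.3, p. 14.
  [cite: Zhang2022LandauSiegel, Lemma 3.3 p.14]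
-/

noncomputable section

open Finset Complex Real

namespace Literature.NumberTheory.LFunctions.Zhang2022.Skeleton

/-! ## Bookkeeping: a sum over the family `Ψ` is a double sum over `p ∼ P` and `ψ (mod p)` primitive -/

open scoped Classical in
/-- **`Σ_{ψ∈Ψ} = Σ_{p∼P} Σ*_{ψ (mod p)}`**: a (finite) sum over the family `Ψ` (the type `Chr D`:
a prime `p` of the window together with a primitive character `ψ (mod p)`) of a quantity depending
on `(p, ψ)` is the double sum over the primes of the window and the primitive characters to each.
[cite: Zhang2022LandauSiegel, §2 p. 5] -/
theorem finsum_chr_eq {M : Type*} [AddCommMonoid M] (D : ℕ)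
    (g : (p : ℕ) → DirichletCharacter ℂ p → M) :
    ∑ᶠ x : Chr D, g x.p x.ψ =
      ∑ p ∈ primeWindow D, ∑ χ : DirichletCharacter ℂ p with χ.IsPrimitive, g p χ := by
  classical
  haveI : Fintype (Chr D) := Fintype.ofFinite (Chr D)
  rw [finsum_eq_sum_of_fintype]
  have hR : ∑ p ∈ primeWindow D, ∑ χ : DirichletCharacter ℂ p with χ.IsPrimitive, g p χ =
      ∑ y ∈ (primeWindow D).sigma
          (fun p => (Finset.univ : Finset (DirichletCharacter ℂ p)).filter fun χ => χ.IsPrimitive),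
        g y.1 y.2 := by
    rw [Finset.sum_sigma]
  rw [hR]
  refine Finset.sum_bij (fun x _ => (⟨x.p, x.ψ⟩ : (p : ℕ) × DirichletCharacter ℂ p))
    (fun x _ => ?_) (fun x₁ _ x₂ _ h => ?_) (fun y hy => ?_) (fun x _ => rfl)
  · simp only [Finset.mem_sigma, Finset.mem_filter, Finset.mem_univ, true_and]
    exact ⟨x.mem, x.prim⟩
  · rcases x₁ with ⟨p, hp, ψ, hψ⟩
    rcases x₂ with ⟨p', hp', ψ', hψ'⟩
    simp only [Sigma.mk.injEq] at h
    obtain ⟨rfl, h2⟩ := h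
    simp only [heq_eq_eq] at h2
    subst h2
    rfl
  · obtain ⟨p, χ⟩ := y
    simp only [Finset.mem_sigma, Finset.mem_filter, Finset.mem_univ, true_and] at hy
    exact ⟨⟨p, hy.1, χ, hy.2⟩, Finset.mem_univ _, rfl⟩

/-- `{1 ≤ n ≤ N} = {0 < n ≤ N}` in `ℕ` (the skeleton writes `n ≤ x` as `Icc 1 ⌊x⌋`, the tree's
mean-value file as `Ioc 0 N`). [folklore] -/
private theorem Icc_one_eq_Ioc (N : ℕ) : Finset.Icc 1 N = Finset.Ioc 0 N := by
  ext n; simp only [Finset.mem_Icc, Finset.mem_Ioc]; omega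

/-- Every modulus of the window exceeds `⌊P⌋` ("`P < p`"). [cite: Zhang2022LandauSiegel, §2 p. 5] -/
private theorem floor_bigP_lt_of_mem {D p : ℕ} (hp : p ∈ primeWindow D) : ⌊bigP D⌋₊ < p := by
  simp only [primeWindow, Finset.mem_filter, Finset.mem_Ioo] at hp
  exact hp.1.1

/-- The window lies in `[1, Q]`, `Q = ⌈P(1 + 𝓛⁻⁶⁸)⌉` ("`p < P(1 + 𝓛⁻⁶⁸)`").
[cite: Zhang2022LandauSiegel, §2 p. 5] -/
private theorem primeWindow_subset_Icc_ceil (D : ℕ) :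
    primeWindow D ⊆ Finset.Icc 1 ⌈bigP D * (1 + (ell D ^ 68)⁻¹)⌉₊ := fun p hp => by
  simp only [primeWindow, Finset.mem_filter, Finset.mem_Ioo] at hp
  exact Finset.mem_Icc.2 ⟨hp.2.one_lt.le, hp.1.2.le⟩

/-! ## Lemma 3.3, first assertion -/

/-- **Lemma 3.3, first assertion, HOLDS** (the node `Skeleton.Lemma33a`), with implied constant
`1`: `Σ_{ψ∈Ψ} |Σ_{n≤P} c(n)ψ(n)n^{−s}|² ≤ 𝔓 Σ_{n≤P} |c(n)|² n^{−2σ}` for every `D`, `s`, `c` —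
orthogonality of characters to each prime modulus `p > P` of the window
(`Zhang2022.weighted_orthogonality_meanValue`). [cite: Zhang2022LandauSiegel, Lemma 3.3 p.14] -/
theorem lemma33a_holds : Lemma33a := by
  refine ⟨1, fun D s c => ?_⟩
  have key := finsum_chr_eq D
    (fun p χ => ‖∑ n ∈ Finset.Icc 1 ⌊bigP D⌋₊, c n * χ (n : ZMod p) * (n : ℂ) ^ (-s)‖ ^ 2)
  rw [key, one_mul, frakP_eq_sum_primeWindow, Icc_one_eq_Ioc]
  have h := weighted_orthogonality_meanValue (primeWindow D) ⌊bigP D⌋₊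
    (fun p hp => floor_bigP_lt_of_mem hp) c s
  simpa only [neg_mul] using h

/-! ## Lemma 3.3, second assertion -/

/-- `𝓛 ≥ 1` for `D ≥ 3`. [cite: Zhang2022LandauSiegel, §2 (2.1)] -/
private theorem one_le_ell {D : ℕ} (hD : 3 ≤ D) : 1 ≤ ell D := by
  have hD' : (3 : ℝ) ≤ D := by exact_mod_cast hD
  have h : (1 : ℝ) < Real.log 3 := by
    rw [Real.lt_log_iff_exp_lt (by norm_num)]
    exact Real.exp_one_lt_d9.trans (by norm_num)
  exact le_trans h.le (Real.log_le_log (by norm_num) hD')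

/-- `𝓛⁻⁶⁸ ≤ 1 + (log 2)⁻⁶⁸` for EVERY modulus `D` (`𝓛⁻⁶⁸ ≤ 1` once `D ≥ 3`; `D = 2` is the one
modulus with `𝓛 < 1`; `D ≤ 1` gives `𝓛 = 0` and Lean's `0⁻¹ = 0`). [folklore] -/
private theorem inv_ell_pow_le (D : ℕ) : (ell D ^ 68)⁻¹ ≤ 1 + (Real.log 2 ^ 68)⁻¹ := by
  have h2 : 0 ≤ (Real.log 2 ^ 68)⁻¹ := by positivity
  rcases Nat.lt_or_ge D 3 with hD | hD
  · interval_cases D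
    · simp only [ell, Nat.cast_zero, Real.log_zero, ne_eq, OfNat.ofNat_ne_zero,
        not_false_eq_true, zero_pow, inv_zero]
      linarith
    · simp only [ell, Nat.cast_one, Real.log_one, ne_eq, OfNat.ofNat_ne_zero,
        not_false_eq_true, zero_pow, inv_zero]
      linarith
    · simp only [ell, Nat.cast_ofNat]
      linarith
  · have h1 : 1 ≤ ell D ^ 68 := one_le_pow₀ (one_le_ell hD)
    exact le_trans (inv_le_one_of_one_le₀ h1) (le_add_of_nonneg_right h2)

/-- `P ≥ 1` (`P = exp 𝓛⁹`, `𝓛 = log D ≥ 0`). [cite: Zhang2022LandauSiegel, §2 (2.6)] -/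
private theorem one_le_bigP (D : ℕ) : 1 ≤ bigP D := by
  have h : 0 ≤ ell D := Real.log_natCast_nonneg D
  exact Real.one_le_exp (by positivity)

/-- The large-sieve factor is `≪ P²` uniformly in `D`:
`⌊P²⌋ + 1 + 2⌈P(1 + 𝓛⁻⁶⁸)⌉² ≤ (2 + 2(3 + (log 2)⁻⁶⁸)²)·P²`.
[cite: Zhang2022LandauSiegel, Lemma 3.3 p.14] -/
private theorem largeSieve_factor_le (D : ℕ) :
    (⌊bigP D ^ 2⌋₊ : ℝ) + 1 + 2 * (⌈bigP D * (1 + (ell D ^ 68)⁻¹)⌉₊ : ℝ) ^ 2 ≤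
      (2 + 2 * (3 + (Real.log 2 ^ 68)⁻¹) ^ 2) * bigP D ^ 2 := by
  set P : ℝ := bigP D with hPdef
  set K : ℝ := (Real.log 2 ^ 68)⁻¹ with hKdef
  have hK : 0 ≤ K := by positivity
  have hP : 1 ≤ P := one_le_bigP D
  have hP0 : 0 ≤ P := le_trans zero_le_one hP
  have hE : 0 ≤ (ell D ^ 68)⁻¹ := inv_nonneg.mpr (pow_nonneg (Real.log_natCast_nonneg D) 68)
  have harg : 0 ≤ P * (1 + (ell D ^ 68)⁻¹) := mul_nonneg hP0 (by linarith)
  have hQ : (⌈P * (1 + (ell D ^ 68)⁻¹)⌉₊ : ℝ) ≤ P * (3 + K) := by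
    have h1 : (⌈P * (1 + (ell D ^ 68)⁻¹)⌉₊ : ℝ) < P * (1 + (ell D ^ 68)⁻¹) + 1 :=
      Nat.ceil_lt_add_one harg
    have h2 : P * (1 + (ell D ^ 68)⁻¹) ≤ P * (1 + (1 + K)) :=
      mul_le_mul_of_nonneg_left (by linarith [inv_ell_pow_le D]) hP0
    nlinarith
  have hQ0 : (0 : ℝ) ≤ ⌈P * (1 + (ell D ^ 68)⁻¹)⌉₊ := Nat.cast_nonneg _
  have hQ2 : (⌈P * (1 + (ell D ^ 68)⁻¹)⌉₊ : ℝ) ^ 2 ≤ (P * (3 + K)) ^ 2 :=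
    pow_le_pow_left₀ hQ0 hQ 2
  have hN : (⌊P ^ 2⌋₊ : ℝ) ≤ P ^ 2 := Nat.floor_le (by positivity)
  have h1 : (1 : ℝ) ≤ P ^ 2 := one_le_pow₀ hP
  calc (⌊P ^ 2⌋₊ : ℝ) + 1 + 2 * (⌈P * (1 + (ell D ^ 68)⁻¹)⌉₊ : ℝ) ^ 2
      ≤ P ^ 2 + P ^ 2 + 2 * (P * (3 + K)) ^ 2 := by linarith
    _ = (2 + 2 * (3 + K) ^ 2) * P ^ 2 := by ring

/-- **Lemma 3.3, second assertion, HOLDS** (the node `Skeleton.Lemma33b`), with the absolute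
implied constant `C = 2 + 2(3 + (log 2)⁻⁶⁸)²`:
`Σ_{ψ∈Ψ} |Σ_{n≤P²} c(n)ψ(n)n^{−s}|² ≤ C·P² Σ_{n≤P²} |c(n)|² n^{−2σ}` for every `D`, `s`, `c` — the
large sieve for primitive characters to moduli `≤ Q = ⌈P(1 + 𝓛⁻⁶⁸)⌉`, length `N = ⌊P²⌋`
(`Zhang2022.weighted_largeSieve_meanValue`, factor `N + 1 + 2Q²`), and `largeSieve_factor_le`.
[cite: Zhang2022LandauSiegel, Lemma 3.3 p.14] -/
theorem lemma33b_holds : Lemma33b := by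
  refine ⟨2 + 2 * (3 + (Real.log 2 ^ 68)⁻¹) ^ 2, fun D s c => ?_⟩
  have key := finsum_chr_eq D
    (fun p χ => ‖∑ n ∈ Finset.Icc 1 ⌊bigP D ^ 2⌋₊, c n * χ (n : ZMod p) * (n : ℂ) ^ (-s)‖ ^ 2)
  rw [key, Icc_one_eq_Ioc]
  have h := weighted_largeSieve_meanValue (primeWindow D) ⌊bigP D ^ 2⌋₊
    ⌈bigP D * (1 + (ell D ^ 68)⁻¹)⌉₊ (primeWindow_subset_Icc_ceil D) c s
  simp only [neg_mul] at h ⊢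
  have hS : 0 ≤ ∑ n ∈ Finset.Ioc 0 ⌊bigP D ^ 2⌋₊, ‖c n‖ ^ 2 * (n : ℝ) ^ (-(2 * s.re)) :=
    Finset.sum_nonneg fun n _ => by positivity
  exact h.trans (mul_le_mul_of_nonneg_right (largeSieve_factor_le D) hS)

/-! ## Consumable forms: sums over any finite subfamily of `Ψ` (e.g. `Ψ₁`)

The manuscript applies Lemma 3.3 to sums over `ψ ∈ Ψ₁ ⊆ Ψ` (§§7, 8, 14). The skeleton writes such
sums as `∑ x ∈ finsetOf (PsiOne χ), …`; the following corollaries bound a sum of the (nonnegative)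
squares over ANY `Finset (Chr D)` by the full sum over `Ψ`. -/

/-- A finite partial sum of nonnegative terms over members of `Ψ` is at most the full sum over `Ψ`.
[cite: Zhang2022LandauSiegel, Lemma 3.3 p.14] -/
theorem sum_le_finsum_chr {D : ℕ} (T : Finset (Chr D)) {f : Chr D → ℝ} (hf : ∀ x, 0 ≤ f x) :
    ∑ x ∈ T, f x ≤ ∑ᶠ x : Chr D, f x := by
  classical
  haveI : Fintype (Chr D) := Fintype.ofFinite (Chr D)
  rw [finsum_eq_sum_of_fintype]
  exact Finset.sum_le_sum_of_subset_of_nonneg (Finset.subset_univ T) fun x _ _ => hf x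

/-- **Lemma 3.3, first assertion, over any finite subfamily** (e.g. `T = finsetOf (PsiOne χ)`), with
the implied constant `1`:
`Σ_{ψ∈T} |Σ_{n≤P} c(n)ψ(n)n^{−s}|² ≤ 𝔓 Σ_{n≤P} |c(n)|² n^{−2σ}`. [cite: Zhang2022LandauSiegel, Lemma 3.3 p.14] -/
theorem lemma33a_sum_le {D : ℕ} (T : Finset (Chr D)) (s : ℂ) (c : ℕ → ℂ) :
    ∑ x ∈ T, ‖∑ n ∈ Finset.Icc 1 ⌊bigP D⌋₊, c n * x.ψ (n : ZMod x.p) * (n : ℂ) ^ (-s)‖ ^ 2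
      ≤ frakP D * ∑ n ∈ Finset.Icc 1 ⌊bigP D⌋₊, ‖c n‖ ^ 2 * (n : ℝ) ^ (-2 * s.re) := by
  have key := finsum_chr_eq D
    (fun p χ => ‖∑ n ∈ Finset.Icc 1 ⌊bigP D⌋₊, c n * χ (n : ZMod p) * (n : ℂ) ^ (-s)‖ ^ 2)
  refine le_trans (sum_le_finsum_chr T fun x => by positivity) ?_
  rw [key, frakP_eq_sum_primeWindow, Icc_one_eq_Ioc]
  have h := weighted_orthogonality_meanValue (primeWindow D) ⌊bigP D⌋₊
    (fun p hp => floor_bigP_lt_of_mem hp) c s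
  simpa only [neg_mul] using h

/-- **Lemma 3.3, second assertion, over any finite subfamily** (e.g. `T = finsetOf (PsiOne χ)`), with
the absolute constant `C = 2 + 2(3 + (log 2)⁻⁶⁸)²` of `lemma33b_holds`:
`Σ_{ψ∈T} |Σ_{n≤P²} c(n)ψ(n)n^{−s}|² ≤ C·P² Σ_{n≤P²} |c(n)|² n^{−2σ}`.
[cite: Zhang2022LandauSiegel, Lemma 3.3 p.14] -/
theorem lemma33b_sum_le {D : ℕ} (T : Finset (Chr D)) (s : ℂ) (c : ℕ → ℂ) :
    ∑ x ∈ T, ‖∑ n ∈ Finset.Icc 1 ⌊bigP D ^ 2⌋₊, c n * x.ψ (n : ZMod x.p) * (n : ℂ) ^ (-s)‖ ^ 2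
      ≤ (2 + 2 * (3 + (Real.log 2 ^ 68)⁻¹) ^ 2) * bigP D ^ 2 *
          ∑ n ∈ Finset.Icc 1 ⌊bigP D ^ 2⌋₊, ‖c n‖ ^ 2 * (n : ℝ) ^ (-2 * s.re) := by
  have key := finsum_chr_eq D
    (fun p χ => ‖∑ n ∈ Finset.Icc 1 ⌊bigP D ^ 2⌋₊, c n * χ (n : ZMod p) * (n : ℂ) ^ (-s)‖ ^ 2)
  refine le_trans (sum_le_finsum_chr T fun x => by positivity) ?_
  rw [key, Icc_one_eq_Ioc]
  have h := weighted_largeSieve_meanValue (primeWindow D) ⌊bigP D ^ 2⌋₊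
    ⌈bigP D * (1 + (ell D ^ 68)⁻¹)⌉₊ (primeWindow_subset_Icc_ceil D) c s
  simp only [neg_mul] at h ⊢
  have hS : 0 ≤ ∑ n ∈ Finset.Ioc 0 ⌊bigP D ^ 2⌋₊, ‖c n‖ ^ 2 * (n : ℝ) ^ (-(2 * s.re)) :=
    Finset.sum_nonneg fun n _ => by positivity
  exact h.trans (mul_le_mul_of_nonneg_right (largeSieve_factor_le D) hS)

/-- The two assertions of Lemma 3.3 packaged for sums over `Ψ₁` as the skeleton writes them
(`∑ x ∈ finsetOf (PsiOne χ)`), with ONE constant `C` serving both. [cite: Zhang2022LandauSiegel, Lemma 3.3 p.14] -/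
theorem lemma33_psiOne : ∃ C : ℝ, ∀ (D : ℕ) [NeZero D] (χ : DirichletCharacter ℂ D) (s : ℂ) (c : ℕ → ℂ),
    (∑ x ∈ finsetOf (PsiOne χ),
        ‖∑ n ∈ Finset.Icc 1 ⌊bigP D⌋₊, c n * x.ψ (n : ZMod x.p) * (n : ℂ) ^ (-s)‖ ^ 2
      ≤ C * frakP D * ∑ n ∈ Finset.Icc 1 ⌊bigP D⌋₊, ‖c n‖ ^ 2 * (n : ℝ) ^ (-2 * s.re)) ∧
    (∑ x ∈ finsetOf (PsiOne χ),
        ‖∑ n ∈ Finset.Icc 1 ⌊bigP D ^ 2⌋₊, c n * x.ψ (n : ZMod x.p) * (n : ℂ) ^ (-s)‖ ^ 2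
      ≤ C * bigP D ^ 2 * ∑ n ∈ Finset.Icc 1 ⌊bigP D ^ 2⌋₊, ‖c n‖ ^ 2 * (n : ℝ) ^ (-2 * s.re)) := by
  refine ⟨2 + 2 * (3 + (Real.log 2 ^ 68)⁻¹) ^ 2, fun D _ χ s c => ⟨?_, lemma33b_sum_le _ s c⟩⟩
  refine le_trans (lemma33a_sum_le _ s c) (mul_le_mul_of_nonneg_right ?_ ?_)
  · have hP : 0 ≤ frakP D := by
      rw [frakP_eq_sum_primeWindow]; exact Finset.sum_nonneg fun p _ => Nat.cast_nonneg p
    have h1 : (1 : ℝ) ≤ 2 + 2 * (3 + (Real.log 2 ^ 68)⁻¹) ^ 2 := by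
      have : 0 ≤ 2 * (3 + (Real.log 2 ^ 68)⁻¹) ^ 2 := by positivity
      linarith
    calc frakP D = 1 * frakP D := (one_mul _).symm
      _ ≤ (2 + 2 * (3 + (Real.log 2 ^ 68)⁻¹) ^ 2) * frakP D := mul_le_mul_of_nonneg_right h1 hP
  · exact Finset.sum_nonneg fun n _ => by positivity

end Literature.NumberTheory.LFunctions.Zhang2022.Skeleton

end
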